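import Summits.AtomisticToContinuum.Crystallization.Theorems.OverbindingBudgetAffineFarFieldCollarAtlas

/-!
# Kernel books on the interface tubes of the Barlow reference tessellation

Support file for route `OverbindingBudget`, crux `RobustDefectLimitWindows` (SW♭(30)·27V, «27VI-SOUND (a3)»): the
`hc`/`hc0` books of `interfaceRow_window` («CollarWindow») — a bound `|g x| ≤ c k` on the tube
`cthickening (W k) (refCell k.1 ∩ refCell k.2)` of every listed pair `k` — from a RADIAL ANTITONE MAJORANT of the
kernel about the window centre `q₀`: `|g x| ≤ Gm (dist x q₀)` for `dist x q₀ ≥ r₁`, `Gm` antitone on `[r₁, ∞)`.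

* §1 Tube localisation: the tube of the pair `k` lies in `closedBall (midpoint k) (pieceRadius k + W k)`
  («CollarWindow» `refCell_inter_subset_closedBall` + `cthickening_closedBall`), hence is compact, and on it
  `dist (midpoint k) q₀ − (pieceRadius k + W k) ≤ dist x q₀ ≤ dist (midpoint k) q₀ + (pieceRadius k + W k)`.
* §2 ★ `hc_of_radial`: if `ρ k ≥ r₁` and `ρ k + pieceRadius k + W k ≤ dist (midpoint k) q₀` then `|g| ≤ Gm (ρ k)` on
  the tube of `k`; `hc0` from `Gm ≥ 0`.
* §3 ★ `hc_of_atlas`: the INTEGER form with the centre at a reference site `q₀ = site u₀`, books `W k = ν·WN k/D`,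
  radii `ρ k = ν·ρN k/D` (scale `D` of «CollarAtlas»): the finite condition
  (A5) `∀ k ∈ I, r₁N ≤ ρN k ∧ 12·(2ρN k + 2WN k + pieceRadiusN k)² ≤ D²·barlowStarForm s u₀ k`
  (Apollonius in integer form, «CollarForms» `fortyEight_mul_dist_placedSite_midpoint_sq`) gives `hc` VERBATIM with
  `c k := Gm (ν·ρN k/D)`.
* §4 Integrability: the tube is compact, so a kernel continuous on it is integrable there (`hgP`); for a kernel
  integrable on `E3` (the cut-off far-field kernel of 27V) `hgA`/`hgB`/`hgP` are `Integrable.integrableOn`.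

References: the tree files cited; Hales, Dense Sphere Packings (2012) §1.3 [HalesDSP2012] for the tessellation.
-/

noncomputable section

namespace Summit.AtomisticToContinuum.Crystallization.Theorems.OverbindingBudgetAffineFarFieldCollarKernel

open Set Metric MeasureTheory Real
open Literature.MathematicalPhysics.StatisticalMechanics (IsHaggSeq)
open Summit.AtomisticToContinuum.Crystallization.Theorems.OverbindingBudgetAffineFarFieldCollarSites
open Summit.AtomisticToContinuum.Crystallization.Theorems.OverbindingBudgetAffineFarFieldCollarWindow
open Summit.AtomisticToContinuum.Crystallization.Theorems.OverbindingBudgetAffineFarFieldCollarForms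
open Summit.AtomisticToContinuum.Crystallization.Theorems.OverbindingBudgetAffineFarFieldCollarAtlas

local notation "E3" => EuclideanSpace ℝ (Fin 3)
local notation "Idx" => ℤ × ℤ × ℤ

variable {s : ℤ → ℤ} {ν : ℝ} {q : E3} {R : E3 ≃ₗᵢ[ℝ] E3}

/-! ## §1 Tube localisation -/

/-- support: the piece radius is nonnegative. [«CollarWindow»] -/
theorem pieceRadius_nonneg (s : ℤ → ℤ) {ν : ℝ} (hν : 0 ≤ ν) (k : Idx × Idx) : 0 ≤ pieceRadius s ν k := by
  unfold pieceRadius; split_ifs <;> positivity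

/-- support: THE TUBE OF A LISTED PAIR lies in the ball of radius `pieceRadius k + W` about the midpoint.
[«CollarWindow» refCell_inter_subset_closedBall + cthickening_closedBall] -/
theorem tube_subset_closedBall (hs : IsHaggSeq s) (hν : 0 < ν) {k : Idx × Idx}
    (hk : barlowSiteForm s k.1 k.2 = 12 ∨ barlowSiteForm s k.1 k.2 = 24) {W : ℝ} (hW : 0 ≤ W) :
    cthickening W (refCell s ν q R k.1 ∩ refCell s ν q R k.2) ⊆
      closedBall (midpoint ℝ (placedSite s ν q R k.1) (placedSite s ν q R k.2)) (pieceRadius s ν k + W) := by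
  rw [add_comm, ← cthickening_closedBall hW (pieceRadius_nonneg s hν.le k)]
  exact cthickening_subset_of_subset W (refCell_inter_subset_closedBall hs hν hk)

/-- support: the tube of a listed pair is compact. [this file] -/
theorem isCompact_pairTube (hs : IsHaggSeq s) (hν : 0 < ν) {k : Idx × Idx}
    (hk : barlowSiteForm s k.1 k.2 = 12 ∨ barlowSiteForm s k.1 k.2 = 24) {W : ℝ} (hW : 0 ≤ W) :
    IsCompact (cthickening W (refCell s ν q R k.1 ∩ refCell s ν q R k.2)) :=
  (isCompact_closedBall _ _).of_isClosed_subset isClosed_cthickening (tube_subset_closedBall hs hν hk hW)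

/-- support: RADIAL WINDOW OF THE TUBE about any centre `q₀`:
`dist (midpoint k) q₀ − (pieceRadius k + W) ≤ dist x q₀ ≤ dist (midpoint k) q₀ + (pieceRadius k + W)`. [this file] -/
theorem dist_window_of_mem_tube (hs : IsHaggSeq s) (hν : 0 < ν) {k : Idx × Idx}
    (hk : barlowSiteForm s k.1 k.2 = 12 ∨ barlowSiteForm s k.1 k.2 = 24) {W : ℝ} (hW : 0 ≤ W) (q₀ : E3) {x : E3}
    (hx : x ∈ cthickening W (refCell s ν q R k.1 ∩ refCell s ν q R k.2)) :
    dist (midpoint ℝ (placedSite s ν q R k.1) (placedSite s ν q R k.2)) q₀ - (pieceRadius s ν k + W) ≤ dist x q₀ ∧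
      dist x q₀ ≤ dist (midpoint ℝ (placedSite s ν q R k.1) (placedSite s ν q R k.2)) q₀ + (pieceRadius s ν k + W) := by
  have hxm := mem_closedBall.1 (tube_subset_closedBall hs hν hk hW hx)
  constructor
  · linarith [dist_triangle (midpoint ℝ (placedSite s ν q R k.1) (placedSite s ν q R k.2)) x q₀, dist_comm x
      (midpoint ℝ (placedSite s ν q R k.1) (placedSite s ν q R k.2))]
  · linarith [dist_triangle x (midpoint ℝ (placedSite s ν q R k.1) (placedSite s ν q R k.2)) q₀]

/-! ## §2 The kernel book from a radial antitone majorant -/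

/-- support: a radial antitone majorant bounds `|g|` on a set lying beyond radius `ρ ≥ r₁` by `Gm ρ`. [this file] -/
theorem abs_le_of_radial {g : E3 → ℝ} {Gm : ℝ → ℝ} {r₁ : ℝ} (q₀ : E3) (hanti : AntitoneOn Gm (Ici r₁))
    (hg : ∀ x, r₁ ≤ dist x q₀ → |g x| ≤ Gm (dist x q₀)) {T : Set E3} {ρ : ℝ} (hρ : r₁ ≤ ρ)
    (hT : ∀ x ∈ T, ρ ≤ dist x q₀) : ∀ x ∈ T, |g x| ≤ Gm ρ := fun x hx =>
  (hg x (hρ.trans (hT x hx))).trans (hanti (mem_Ici.2 hρ) (mem_Ici.2 (hρ.trans (hT x hx))) (hT x hx))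

/-- ★ support: `hc` OF THE INTERFACE ROW from a radial antitone majorant: with radii `ρ k ≥ r₁` such that
`ρ k + pieceRadius k + W k ≤ dist (midpoint k) q₀`, `|g| ≤ Gm (ρ k)` on the tube of every listed pair. [this file] -/
theorem hc_of_radial (hs : IsHaggSeq s) (hν : 0 < ν) (q₀ : E3) (I : Finset (Idx × Idx)) (W : Idx × Idx → ℝ)
    (hI' : ∀ k ∈ I, barlowSiteForm s k.1 k.2 = 12 ∨ barlowSiteForm s k.1 k.2 = 24) (hW0 : ∀ k ∈ I, 0 ≤ W k)
    {g : E3 → ℝ} {Gm : ℝ → ℝ} {r₁ : ℝ} (hanti : AntitoneOn Gm (Ici r₁))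
    (hg : ∀ x, r₁ ≤ dist x q₀ → |g x| ≤ Gm (dist x q₀)) (ρ : Idx × Idx → ℝ) (hρ₁ : ∀ k ∈ I, r₁ ≤ ρ k)
    (hρ : ∀ k ∈ I, ρ k + pieceRadius s ν k + W k ≤ dist (midpoint ℝ (placedSite s ν q R k.1) (placedSite s ν q R k.2)) q₀) :
    ∀ k ∈ I, ∀ x ∈ cthickening (W k) (refCell s ν q R k.1 ∩ refCell s ν q R k.2), |g x| ≤ Gm (ρ k) := fun k hk =>
  abs_le_of_radial q₀ hanti hg (hρ₁ k hk) fun x hx => by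
    have h := (dist_window_of_mem_tube hs hν (hI' k hk) (hW0 k hk) q₀ hx).1
    linarith [hρ k hk]

/-- support: `hc0` of the interface row: the books `Gm (ρ k)` are nonnegative when `Gm ≥ 0` on `[r₁, ∞)`. [this file] -/
theorem hc0_of_radial (I : Finset (Idx × Idx)) {Gm : ℝ → ℝ} {r₁ : ℝ} (hGm : ∀ r, r₁ ≤ r → 0 ≤ Gm r)
    (ρ : Idx × Idx → ℝ) (hρ₁ : ∀ k ∈ I, r₁ ≤ ρ k) : ∀ k ∈ I, 0 ≤ Gm (ρ k) := fun k hk => hGm _ (hρ₁ k hk)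

/-! ## §3 The integer form (atlas condition (A5)) -/

/-- support: the integer star test bounds the real radius from below: if `0 ≤ n` and `12·n² ≤ D²·barlowStarForm s u₀ k`
then `ν·n/(2D) ≤ dist (site u₀) (midpoint k)`. [«CollarForms» fortyEight_mul_dist_placedSite_midpoint_sq] -/
theorem scale_le_dist_midpoint_of_sq_le (hν : 0 < ν) {D : ℕ} (hD : 0 < D) (u₀ : Idx) (k : Idx × Idx) {n : ℤ} (hn : 0 ≤ n)
    (h : 12 * n ^ 2 ≤ (D : ℤ) ^ 2 * barlowStarForm s u₀ k) :
    ν * (n : ℝ) / (2 * D) ≤ dist (placedSite s ν q R u₀) (midpoint ℝ (placedSite s ν q R k.1) (placedSite s ν q R k.2)) := by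
  have hDr : (0 : ℝ) < D := by exact_mod_cast hD
  have h48 := fortyEight_mul_dist_placedSite_midpoint_sq (s := s) (q := q) (R := R) hν.le u₀ k.1 k.2
  have h' : (12 : ℝ) * (n : ℝ) ^ 2 ≤ (D : ℝ) ^ 2 * (barlowStarForm s u₀ k : ℝ) := by exact_mod_cast h
  have hstar : (barlowStarForm s u₀ k : ℝ) =
      2 * (barlowSiteForm s u₀ k.1 : ℝ) + 2 * (barlowSiteForm s u₀ k.2 : ℝ) - (barlowSiteForm s k.1 k.2 : ℝ) := by
    unfold barlowStarForm; push_cast; ring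
  rw [← pow_le_pow_iff_left₀ (by positivity) dist_nonneg two_ne_zero]
  -- (ν n/(2D))² = ν² n²/(4D²) ≤ ν²·star/48 = dist²
  have e : (ν * (n : ℝ) / (2 * D)) ^ 2 = ν ^ 2 * ((n : ℝ) ^ 2 / (4 * (D : ℝ) ^ 2)) := by
    field_simp
    ring
  have hle : (n : ℝ) ^ 2 / (4 * (D : ℝ) ^ 2) ≤ (barlowStarForm s u₀ k : ℝ) / 48 := by
    rw [div_le_div_iff₀ (by positivity) (by norm_num)]
    nlinarith
  calc (ν * (n : ℝ) / (2 * D)) ^ 2 = ν ^ 2 * ((n : ℝ) ^ 2 / (4 * (D : ℝ) ^ 2)) := e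
    _ ≤ ν ^ 2 * ((barlowStarForm s u₀ k : ℝ) / 48) := mul_le_mul_of_nonneg_left hle (by positivity)
    _ = dist (placedSite s ν q R u₀) (midpoint ℝ (placedSite s ν q R k.1) (placedSite s ν q R k.2)) ^ 2 := by
        rw [hstar]; linear_combination (-1 / 48 : ℝ) * h48

/-- ★★ `hc` OF THE INTERFACE ROW FROM THE FINITE CONDITION (A5): centre at the reference site `q₀ = site u₀`,
books `W k = ν·WN k/D`, kernel radii `ρ k = ν·ρN k/D`, validity radius `r₁ = ν·r₁N/D`; if for every listed pair
`r₁N ≤ ρN k` and `12·(2ρN k + 2WN k + pieceRadiusN k)² ≤ D²·barlowStarForm s u₀ k` (with `0 ≤ 2ρN k + 2WN k + ρN_piece`),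
then `|g x| ≤ Gm (ν·ρN k/D)` on the tube of `k`. [this file] -/
theorem hc_of_atlas (hs : IsHaggSeq s) (hν : 0 < ν) (u₀ : Idx) (I : Finset (Idx × Idx))
    (hI' : ∀ k ∈ I, barlowSiteForm s k.1 k.2 = 12 ∨ barlowSiteForm s k.1 k.2 = 24) {D : ℕ} (hD : 0 < D)
    (WN ρN : Idx × Idx → ℤ) (A4 : ∀ k ∈ I, 0 ≤ WN k) {r₁N : ℤ} {g : E3 → ℝ} {Gm : ℝ → ℝ}
    (hanti : AntitoneOn Gm (Ici (ν * (r₁N : ℝ) / D)))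
    (hg : ∀ x, ν * (r₁N : ℝ) / D ≤ dist x (placedSite s ν q R u₀) → |g x| ≤ Gm (dist x (placedSite s ν q R u₀)))
    (A5 : ∀ k ∈ I, r₁N ≤ ρN k ∧ 0 ≤ 2 * ρN k + 2 * WN k + pieceRadiusN s D k ∧
      12 * (2 * ρN k + 2 * WN k + pieceRadiusN s D k) ^ 2 ≤ (D : ℤ) ^ 2 * barlowStarForm s u₀ k) :
    ∀ k ∈ I, ∀ x ∈ cthickening (ν * (WN k : ℝ) / D) (refCell s ν q R k.1 ∩ refCell s ν q R k.2),
      |g x| ≤ Gm (ν * (ρN k : ℝ) / D) := by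
  have hDr : (0 : ℝ) < D := by exact_mod_cast hD
  refine hc_of_radial hs hν (placedSite s ν q R u₀) I (fun k => ν * (WN k : ℝ) / D) hI'
    (fun k hk => div_nonneg (mul_nonneg hν.le (by exact_mod_cast A4 k hk)) hDr.le) hanti hg
    (fun k => ν * (ρN k : ℝ) / D) (fun k hk => ?_) (fun k hk => ?_)
  · exact div_le_div_of_nonneg_right (mul_le_mul_of_nonneg_left (by exact_mod_cast (A5 k hk).1) hν.le) hDr.le
  · obtain ⟨-, hn, hsq⟩ := A5 k hk
    have h := scale_le_dist_midpoint_of_sq_le (s := s) (q := q) (R := R) hν hD u₀ k hn hsq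
    rw [dist_comm] at h
    rw [pieceRadius_eq s ν hD k]
    have e : ν * (ρN k : ℝ) / D + ν * (pieceRadiusN s D k : ℝ) / (2 * D) + ν * (WN k : ℝ) / D =
        ν * ((2 * ρN k + 2 * WN k + pieceRadiusN s D k : ℤ) : ℝ) / (2 * D) := by
      push_cast; field_simp; ring
    rw [e]
    exact h

/-- support: `hc0` in the integer form: `0 ≤ Gm (ν·ρN k/D)` when `Gm ≥ 0` on `[ν·r₁N/D, ∞)` and `r₁N ≤ ρN k`.
[this file] -/
theorem hc0_of_atlas (hν : 0 < ν) (I : Finset (Idx × Idx)) {D : ℕ} (hD : 0 < D) (ρN : Idx × Idx → ℤ) {r₁N : ℤ}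
    {Gm : ℝ → ℝ} (hGm : ∀ r, ν * (r₁N : ℝ) / D ≤ r → 0 ≤ Gm r) (A5 : ∀ k ∈ I, r₁N ≤ ρN k) :
    ∀ k ∈ I, 0 ≤ Gm (ν * (ρN k : ℝ) / D) := by
  have hDr : (0 : ℝ) < D := by exact_mod_cast hD
  exact fun k hk => hGm _ (div_le_div_of_nonneg_right (mul_le_mul_of_nonneg_left (by exact_mod_cast A5 k hk) hν.le) hDr.le)

/-! ## §4 Integrability on the tubes and the cores -/

/-- support: `hgP` of the interface row for a kernel continuous on the (compact) tube. [this file] -/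
theorem integrableOn_tube_of_continuousOn (hs : IsHaggSeq s) (hν : 0 < ν) {k : Idx × Idx}
    (hk : barlowSiteForm s k.1 k.2 = 12 ∨ barlowSiteForm s k.1 k.2 = 24) {W : ℝ} (hW : 0 ≤ W) {g : E3 → ℝ}
    (hg : ContinuousOn g (cthickening W (refCell s ν q R k.1 ∩ refCell s ν q R k.2))) :
    IntegrableOn g (cthickening W (refCell s ν q R k.1 ∩ refCell s ν q R k.2)) :=
  hg.integrableOn_compact (isCompact_pairTube hs hν hk hW)

/-- support: `hgP` for a kernel continuous beyond radius `r₁` about `q₀`, on a tube lying beyond `r₁`. [this file] -/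
theorem integrableOn_tube_of_continuousOn_far (hs : IsHaggSeq s) (hν : 0 < ν) {k : Idx × Idx}
    (hk : barlowSiteForm s k.1 k.2 = 12 ∨ barlowSiteForm s k.1 k.2 = 24) {W : ℝ} (hW : 0 ≤ W) (q₀ : E3) {r₁ : ℝ}
    {g : E3 → ℝ} (hg : ContinuousOn g {x | r₁ ≤ dist x q₀})
    (hρ : r₁ + pieceRadius s ν k + W ≤ dist (midpoint ℝ (placedSite s ν q R k.1) (placedSite s ν q R k.2)) q₀) :
    IntegrableOn g (cthickening W (refCell s ν q R k.1 ∩ refCell s ν q R k.2)) :=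
  integrableOn_tube_of_continuousOn hs hν hk hW (hg.mono fun x hx => by
    have h := (dist_window_of_mem_tube hs hν hk hW q₀ hx).1
    show r₁ ≤ dist x q₀
    linarith)

/-- support: `hgA`/`hgB`/`hgP` at once for a kernel integrable on space (the cut-off far-field kernel). [Mathlib] -/
theorem integrableOn_of_integrable {g : E3 → ℝ} (hg : Integrable g) (S : Set E3) : IntegrableOn g S :=
  hg.integrableOn

end Summit.AtomisticToContinuum.Crystallization.Theorems.OverbindingBudgetAffineFarFieldCollarKernel
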